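/-
Copyright (c) 2026 the pub-hodgecm-mathlib formalisation cell (harness21).  Prover seat hodgecm-mathlib-LH4-p16 (g0), req620 Track A «(D-RAM) FOUR-FRAME» squad
(STAGE-1b, row (2) of the piece `f_{T₊}`, the (β₂) road under heir LEAD F0P3a-plan (g21) T20-18 (R-36) «PURE-CELL LEDGER»; row (L-K0) holder; β₂-board sub-dealer LH4-p04 (g8)
BETA2-BOARD v1 da0f832c §0 currency `hum : |u₀₀ − 1| ≤ |ϖ^m|`), 2026-09-04.
-/
import Summits.HodgeConjecture.HodgeConjecture.Theorems.F0P3cDyRamGlueLabelPlaneDominated     -- ★ (LH4-p13 (g8)): `setOf_thicken_add_small_eq`; brings ★ p860233 `…BlockGlueValueSet` (`valueSet_endoGL_sub_one_glued_eq_plane`, `pairing_endoGL_sub_one_glued_plane`), ★ census DEFS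
import Summits.HodgeConjecture.HodgeConjecture.Theorems.F0P3cDyRamBlockGlueLabelFibreConstant  -- ★ p861015 (LH4-p04 (g8)): `pairing_self_eq_plane_add_line` (`⟨v,v⟩_H = ⟨pr v, pr v⟩_{H₂} + σ(v₁)·h·v₁`)
import HarnessLib

/-!
# Crux `H413`, line LH4 «(D-RAM) FOUR-FRAME» — STAGE-1b, row (2), the (β₂) road (R-36): «THE DEPTH-FORM LETTER» — under `|u₀₀ − 1| ≤ |ϖ^m|` the `ϖ^m`-value set of `Γ − 1` on an
# INTEGRAL glued vertex is the `ϖ^m`-value set of the DEPTH FORM `β′ ↦ ⟨β′, (γ₂ − u)β′⟩_{H₂}` on its plane projection `B₂ + 𝒪·w₀` — no plane∕line dichotomy; a `γ₂`-commuting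
# similitude of multiplier `ξ` then multiplies the letter by `ξ` on EVERY cell

Cell `hodgecm-mathlib` (D-0151), FLOOR 0, crux item H413 = `stmt-HodgeConjecture-24833`, route of record `HCCMUnconditional`; squad F0∕P3c∕LH4; lane
`--supports stmt-HodgeConjecture-24833 --as helper` (count-neutral; pays NO tier-0 row).  THEOREMS ONLY (no `def`, no instance, no notation, no `sorry`, default heartbeats);
★-only imports; states NO law; (β₂) stays a HYPOTHESIS.  DATUM-FREE lattice algebra in the plane letters of ★ p860233 `F0P3cDyRamBlockGlueValueSet` (`K` valued, `σ` any ring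
endomorphism — isometric where said —, block form `H = !![H₂ 0 0, 0, H₂ 0 1; 0, h, 0; H₂ 1 0, 0, H₂ 1 1]`, block element `Γ = endoGL (γ₂, u)`; no residue field, no `|2|`, no self-duality
beyond the INTEGRALITY `⟨y, y⟩_H ∈ 𝒪` of the vertex).

WHY (BETA2-BOARD v1 §0; LH4-cdis1 (g0) BETA2-CELLCHECK v1 cf94291e; F0P3-p01 (g36) GLUEFIBRE 91d9b231).  Every row of the pure-cell ledger ((L-D), (L-S1∕S2), (L-K0), (L-P)) must READ
the label of a Γ-fixed self-dual vertex `L` over a plane lattice `Λ`; the currency fixes `hum : |u₀₀ − 1| ≤ |ϖ^{m}|` (`m = m*`, the neighbourhood shrunk by ★ `exists_nhds_one_block_congr`).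
★ p860233 writes the value of `Γ − 1` on a glued vector `y = ι_W β + a·x₀` as `⟨β′, (γ₂ − u)β′⟩_{H₂} + (u − 1)·(⟨β′, β′⟩_{H₂} + σ(t)·h·t)` (`β′ = β + a·w₀`, `t = a·x₀ 1`), and the two
(β₂)-road files ★ `…GlueLabelPlaneDominated` (LH4-p13) ∕ ★-cand `…GlueLabelLineDominated` (LH4-p15) drop the summand that happens to be `ϖ^m`-small.  THIS FILE observes that the
bracket IS `⟨y, y⟩_H` (★ p861015 `pairing_self_eq_plane_add_line`): `⟨y, (Γ − 1)y⟩_H = ⟨β′, (γ₂ − u)β′⟩_{H₂} + (u − 1)·⟨y, y⟩_H` EXACTLY (`Γ − u·1` kills the line coordinate), so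
on an INTEGRAL vertex (`⟨y, y⟩_H ∈ 𝒪` — every self-dual one) under `hum` the second summand is absorbed by the `ϖ^m`-thickening WITHOUT any smallness of the plane or the line
term (the large parts `(u − 1)⟨β′, β′⟩` and `(u − 1)·h·N(a·x₀ 1)` cancel into `(u − 1)⟨y, y⟩`):
* §1 `pairing_endoGL_sub_one_glued_eq_depth_add_self` — the identity, in ★ p860233's glue letters.
* §2 HEAD `valueSet_endoGL_sub_one_glued_eq_depthSet_of_v_sub_one_le` — general block form `(H₂, h)` (= the `VS_H` letters of LH4-p04's (S4-cells) §1 ∕ BETA2-BOARD §0): for an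
  integral glued vertex under `hum`, `{z ∣ ∃ y ∈ M, |(ϖ^m)⁻¹(z − ⟨y, (Γ − 1)y⟩_H)| ≤ 1} = {z ∣ ∃ β ∈ B₂, ∃ a, |a| ≤ 1 ∧ |(ϖ^m)⁻¹(z − ⟨β′, (γ₂ − u)β′⟩_{H₂})| ≤ 1}` — the
  DEPTH-FORM value set of the plane projection `B₂ + 𝒪·w₀` (= `dualLatt B₂` = `φ⁻¹(Λ^#)` by ★ `exists_coneData_of_gen`); at `(antidiag₂, 1)` the census letter
  `latticeValueSetMod_glued_eq_depthSet_of_v_sub_one_le`.  CONSEQUENCES: the letter is a function of the plane data ALONE — glue-blind for free (★ p861015 §2 is the «same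
  `(B₂, w₀)` ⇒ same letter» shadow), and it does not see the line coefficient `h` at all (under `hum` the literal dependence of a label enters only through `γ₂`, `u`, `H₂` and `Λ`).
* §3 «DEPTH SCALING» — `depthPairing_mulVec_eq` ∕ `depthSet_map_eq_image_mul`: a `γ₂`-commuting similitude `ε` of `(K², H₂)` with unit multiplier `ξ` multiplies EVERY depth value
  by `ξ`, hence the depth set over `(ε·B₂, ε·w₀)` is `(ξ·) ''` the one over `(B₂, w₀)`; HEAD `valueSet_endoGL_sub_one_glued_map_eq_image_mul_of_v_sub_one_le` ∕ census twin: for two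
  integral glued vertices under `hum`, over `(B₂, w₀)` and `(ε·B₂, ε·w₀)`, the letter of the second is `(ξ·) ''` the letter of the first — ★ p861069's «PLANE SCALING» with NO
  plane-domination hypothesis, i.e. the `hvs` dictionary of ★ p861154 §4 ∕ ★ p861208 ∕ ★ p861237 on EVERY cone cell (axis or tube, below or above the conductor).
WHAT THIS MEANS FOR THE ROWS (not proved here): the label of the vertex over `Λ ∈ levelSetDep(j, b; μ)` is the class of `DVS_m(Λ) = thick_m{jE⁻¹ Tr_ρ(h·Θx·μ·x) ∣ x ∈ Λ^#}`; on the
`w₀`-ray it contains the DEPTH SCALAR `e₀(Λ) = ⟨w₀, (γ₂ − u)w₀⟩ ∈ 𝒪` (cone condition `(γ₂ − u)w₀ ∈ B₂`); PURITY of a cell = «the class of `DVS_m(Λ)` is constant on the cell»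
((L-K0): `e₀`-class constant + the `ϖE^j` cross terms below `ϖ^m`), BALANCE = a cell symmetry moving it by a non-norm (§3).
HONEST LABEL.  Count-neutral lattice algebra; nothing printed is asserted; no census law is stated; `HC_CM` is proved only modulo the 7 printed citations (2 remaining named inputs:
hLiu418 = `stmt-HodgeConjecture-24832`, h413 = `stmt-HodgeConjecture-24833`) until rung 0 closes.
## References
* [Jacobowitz1962] R. Jacobowitz, *Hermitian forms over local fields*, Amer. J. Math. 84 (1962): §4 (dual lattices, modular components, gluing; similitudes of hermitian planes).
* [Rogawski1990] J. D. Rogawski, *Automorphic Representations of Unitary Groups in Three Variables*, Ann. of Math. Stud. 123 (1990): §4.8 Case (a) p. 53, §4.9 Prop. 4.9.1 (b) p. 55.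
* [Kottwitz1986BaseChangeUnits] R. E. Kottwitz, *Base change for unit elements of Hecke algebras*, Compositio Math. 60 (1986): §1 pp. 240–241.
* [BruhatTits1972] F. Bruhat, J. Tits, *Groupes réductifs sur un corps local I*, Publ. Math. IHÉS 41 (1972): §10 (lattice models of the rank-one building; tube layers).
-/

set_option autoImplicit false

noncomputable section

namespace Summit.HodgeConjecture.HodgeConjecture.Cruxes.H413.F0P3cDyRamGlueValueDepthForm

open scoped Valued WithZero Matrix MatrixGroups
open WithZero
open Literature.NumberTheory.Automorphic Literature.NumberTheory.Automorphic.HermitianLattice Literature.NumberTheory.Automorphic.UnitaryLatticeTree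
open Literature.NumberTheory.Rogawski1990
open Summit.HodgeConjecture.HodgeConjecture.Cruxes.H413.F0P3cDyRamBlockGlueValueSet
open Summit.HodgeConjecture.HodgeConjecture.Cruxes.H413.F0P3cDyRamFourFrameCensusDefs (latticeValueSetMod LatticeLabelPlus)
open Summit.HodgeConjecture.HodgeConjecture.Cruxes.H413.F0P3cDyRamGlueLabelPlaneDominated (setOf_thicken_add_small_eq)
open Summit.HodgeConjecture.HodgeConjecture.Cruxes.H413.F0P3cDyRamBlockGlueLabelFibreConstant (pairing_self_eq_plane_add_line)

variable {K : Type*} [Field K] [Valued K ℤᵐ⁰]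

/-! ## §1 The identity: value of `Γ − 1` = depth value of the plane part + `(u − 1)`·(the `H`-norm of the vector) -/

omit [Valued K ℤᵐ⁰] in
/-- **`⟨y, (Γ − 1)y⟩_H = ⟨β′, (γ₂ − u)β′⟩_{H₂} + (u − 1)·⟨y, y⟩_H` ON A GLUED VECTOR `y = ι_W β + a·x₀`** (`β′ = β + a·w₀`; ★ p860233 `pairing_endoGL_sub_one_glued_plane` + ★ p861015
`pairing_self_eq_plane_add_line`: the bracket `⟨β′, β′⟩_{H₂} + σ(a·x₀ 1)·h·(a·x₀ 1)` IS `⟨y, y⟩_H`). [cite: Jacobowitz1962, §4] [cite: Rogawski1990, §4.8 Case (a) p. 53] -/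
theorem pairing_endoGL_sub_one_glued_eq_depth_add_self (σ : K →+* K) (H₂ : Matrix (Fin 2) (Fin 2) K) (h : K)
    {w₀ : Fin 2 → K} {x₀ : Fin 3 → K} (hprx : x₀ - Pi.single 1 (x₀ 1) = ![w₀ 0, 0, w₀ 1])
    (γ₂ : GL (Fin 2) K) (u : GL (Fin 1) K) (β : Fin 2 → K) (a : K) :
    pairing σ (!![H₂ 0 0, 0, H₂ 0 1; 0, h, 0; H₂ 1 0, 0, H₂ 1 1] : Matrix (Fin 3) (Fin 3) K) ((![β 0, 0, β 1] : Fin 3 → K) + a • x₀)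
        ((((endoGL (γ₂, u) : GL (Fin 3) K) : Matrix (Fin 3) (Fin 3) K) - 1) *ᵥ ((![β 0, 0, β 1] : Fin 3 → K) + a • x₀)) =
      pairing σ H₂ (β + a • w₀) ((((γ₂ : Matrix (Fin 2) (Fin 2) K) - (u : Matrix (Fin 1) (Fin 1) K) 0 0 • (1 : Matrix (Fin 2) (Fin 2) K))) *ᵥ (β + a • w₀)) +
        ((u : Matrix (Fin 1) (Fin 1) K) 0 0 - 1) *
          pairing σ (!![H₂ 0 0, 0, H₂ 0 1; 0, h, 0; H₂ 1 0, 0, H₂ 1 1] : Matrix (Fin 3) (Fin 3) K) ((![β 0, 0, β 1] : Fin 3 → K) + a • x₀) ((![β 0, 0, β 1] : Fin 3 → K) + a • x₀) := by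
  have hx0 : x₀ 0 = w₀ 0 := by have := congrFun hprx 0; simpa using this
  have hx2 : x₀ 2 = w₀ 1 := by have := congrFun hprx 2; simpa using this
  have hpr : (![((![β 0, 0, β 1] : Fin 3 → K) + a • x₀) 0, ((![β 0, 0, β 1] : Fin 3 → K) + a • x₀) 2] : Fin 2 → K) = β + a • w₀ := by
    ext i; fin_cases i <;> simp [hx0, hx2]
  have h1 : ((![β 0, 0, β 1] : Fin 3 → K) + a • x₀) 1 = a * x₀ 1 := by simp
  rw [pairing_endoGL_sub_one_glued_plane σ H₂ h hprx γ₂ u β a, pairing_self_eq_plane_add_line σ H₂ h, hpr, h1]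

/-- **THE ABSORBED TERM IS `ϖ^m`-SMALL**: if `|⟨y, y⟩_H| ≤ 1` and `|u₀₀ − 1| ≤ |ϖ^m|` then `|(ϖ^m)⁻¹·((u₀₀ − 1)·⟨y, y⟩_H)| ≤ 1`. [cite: Jacobowitz1962, §4] -/
theorem v_inv_mul_sub_one_mul_le_one {ϖ : K} (hϖ0 : ϖ ≠ 0) (m : ℕ) {c s : K} (hc : Valued.v (c - 1) ≤ Valued.v (ϖ ^ m)) (hs : Valued.v s ≤ 1) :
    Valued.v ((ϖ ^ m)⁻¹ * ((c - 1) * s)) ≤ 1 := by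
  have hϖm0 : Valued.v (ϖ ^ m) ≠ 0 := (Valuation.ne_zero_iff _).2 (pow_ne_zero m hϖ0)
  rw [map_mul, map_mul, map_inv₀]
  calc (Valued.v (ϖ ^ m))⁻¹ * (Valued.v (c - 1) * Valued.v s) ≤ (Valued.v (ϖ ^ m))⁻¹ * (Valued.v (ϖ ^ m) * 1) := by gcongr
    _ = 1 := by rw [mul_one, inv_mul_cancel₀ hϖm0]

/-! ## §2 HEAD — the value set of `Γ − 1` on an integral glued vertex under `|u₀₀ − 1| ≤ |ϖ^m|` is the DEPTH-FORM value set of its plane projection -/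

/-- **«THE DEPTH-FORM LETTER» (general block form `(H₂, h)`).**  In ★ p860233's glue letters (`hpr, hB, hx₀, hx₀1, hprx`) for an INTEGRAL vertex `M` (`|⟨y, y⟩_H| ≤ 1` on `M` —
every self-dual lattice) and `|u₀₀ − 1| ≤ |ϖ^m|`:  `{z ∣ ∃ y ∈ M, |(ϖ^m)⁻¹(z − ⟨y, (Γ − 1)y⟩_H)| ≤ 1} = {z ∣ ∃ β ∈ B₂, ∃ a, |a| ≤ 1 ∧ |(ϖ^m)⁻¹(z − ⟨β′, (γ₂ − u₀₀)β′⟩_{H₂})| ≤ 1}`,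
`β′ = β + a·w₀` — the `ϖ^m`-thickened value set of the depth form on `B₂ + 𝒪·w₀`.  No smallness of the plane or of the line term is assumed.
[cite: Jacobowitz1962, §4] [cite: Rogawski1990, §4.9 Prop. 4.9.1 (b) p. 55] [cite: Kottwitz1986BaseChangeUnits, §1 pp. 240–241] [cite: BruhatTits1972, §10] -/
theorem valueSet_endoGL_sub_one_glued_eq_depthSet_of_v_sub_one_le (σ : K →+* K) {ϖ : K} (hϖ : Valued.v ϖ = exp (-1 : ℤ)) (H₂ : Matrix (Fin 2) (Fin 2) K) (h : K)
    {M : Submodule 𝒪[K] (Fin 3 → K)} {b : ℕ} (hpr : ∀ x ∈ M, Valued.v (x 1) * Valued.v ϖ ^ b ≤ 1)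
    (hint : ∀ y ∈ M, Valued.v (pairing σ (!![H₂ 0 0, 0, H₂ 0 1; 0, h, 0; H₂ 1 0, 0, H₂ 1 1] : Matrix (Fin 3) (Fin 3) K) y y) ≤ 1)
    {B₂ : Submodule 𝒪[K] (Fin 2 → K)} {w₀ : Fin 2 → K} {x₀ : Fin 3 → K}
    (hB : B₂.map ((Matrix.toLin' (!![1, 0; 0, 0; 0, 1] : Matrix (Fin 3) (Fin 2) K)).restrictScalars 𝒪[K]) =
      M ⊓ LinearMap.ker ((LinearMap.proj (1 : Fin 3) : (Fin 3 → K) →ₗ[K] K).restrictScalars 𝒪[K]))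
    (hx₀ : x₀ ∈ M) (hx₀1 : Valued.v (x₀ 1) * Valued.v ϖ ^ b = 1) (hprx : x₀ - Pi.single 1 (x₀ 1) = ![w₀ 0, 0, w₀ 1])
    (γ₂ : GL (Fin 2) K) (u : GL (Fin 1) K) (m : ℕ) (hum : Valued.v ((u : Matrix (Fin 1) (Fin 1) K) 0 0 - 1) ≤ Valued.v (ϖ ^ m)) :
    {z : K | ∃ y ∈ M, Valued.v ((ϖ ^ m)⁻¹ * (z - pairing σ (!![H₂ 0 0, 0, H₂ 0 1; 0, h, 0; H₂ 1 0, 0, H₂ 1 1] : Matrix (Fin 3) (Fin 3) K) y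
        ((((endoGL (γ₂, u) : GL (Fin 3) K) : Matrix (Fin 3) (Fin 3) K) - 1) *ᵥ y))) ≤ 1} =
      {z : K | ∃ β ∈ B₂, ∃ a : K, Valued.v a ≤ 1 ∧
        Valued.v ((ϖ ^ m)⁻¹ * (z - pairing σ H₂ (β + a • w₀) ((((γ₂ : Matrix (Fin 2) (Fin 2) K) - (u : Matrix (Fin 1) (Fin 1) K) 0 0 • (1 : Matrix (Fin 2) (Fin 2) K))) *ᵥ (β + a • w₀)))) ≤ 1} := by
  have hvϖ0 : Valued.v ϖ ≠ 0 := by rw [hϖ]; exact exp_ne_zero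
  have hϖ0 : ϖ ≠ 0 := fun h0 => by rw [h0, map_zero] at hvϖ0; exact hvϖ0 rfl
  rw [valueSet_endoGL_sub_one_glued_eq_plane σ hϖ H₂ h hpr hB hx₀ hx₀1 hprx γ₂ u m]
  refine setOf_thicken_add_small_eq ϖ m B₂
    (fun β a => pairing σ H₂ (β + a • w₀) ((((γ₂ : Matrix (Fin 2) (Fin 2) K) - (u : Matrix (Fin 1) (Fin 1) K) 0 0 • (1 : Matrix (Fin 2) (Fin 2) K))) *ᵥ (β + a • w₀)))
    (fun β a => ((u : Matrix (Fin 1) (Fin 1) K) 0 0 - 1) * (pairing σ H₂ (β + a • w₀) (β + a • w₀) + σ (a * x₀ 1) * h * (a * x₀ 1))) fun β hβ a ha => ?_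
  -- the bracket is `⟨y, y⟩_H` for the glued vector `y = ι_W β + a·x₀ ∈ M`
  have hy : (![β 0, 0, β 1] : Fin 3 → K) + a • x₀ ∈ M := (mem_glued_iff_exists_plane hϖ hpr hB hx₀ hx₀1 _).2 ⟨β, hβ, a, ha, rfl⟩
  have hself := pairing_endoGL_sub_one_glued_eq_depth_add_self σ H₂ h hprx γ₂ u β a
  rw [pairing_endoGL_sub_one_glued_plane σ H₂ h hprx γ₂ u β a, add_right_inj] at hself
  rw [hself]
  exact v_inv_mul_sub_one_mul_le_one hϖ0 m hum (hint _ hy)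

/-- **«THE DEPTH-FORM LETTER» FOR THE CENSUS** (`Φ₃ = block(antidiag₂, 1)`, ★ p860233 §4): for an integral glued vertex under `|u₀₀ − 1| ≤ |ϖ^m|`, ★ census DEFS
`latticeValueSetMod σ ϖ m M (Γ − 1) = {z ∣ ∃ β ∈ B₂, ∃ a, |a| ≤ 1 ∧ |(ϖ^m)⁻¹(z − ⟨β′, (γ₂ − u₀₀)β′⟩_{Φ₂})| ≤ 1}` — the set whose class is the `f_{T₊}` label `LatticeLabelPlus`.
[cite: Rogawski1990, §4.9 Prop. 4.9.1 (b) p. 55] [cite: Jacobowitz1962, §4] -/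
theorem latticeValueSetMod_glued_eq_depthSet_of_v_sub_one_le (σ : K →+* K) {ϖ : K} (hϖ : Valued.v ϖ = exp (-1 : ℤ))
    {M : Submodule 𝒪[K] (Fin 3 → K)} {b : ℕ} (hpr : ∀ x ∈ M, Valued.v (x 1) * Valued.v ϖ ^ b ≤ 1)
    (hint : ∀ y ∈ M, Valued.v (pairing σ ((StdForm.antidiagonal 3).over K) y y) ≤ 1)
    {B₂ : Submodule 𝒪[K] (Fin 2 → K)} {w₀ : Fin 2 → K} {x₀ : Fin 3 → K}
    (hB : B₂.map ((Matrix.toLin' (!![1, 0; 0, 0; 0, 1] : Matrix (Fin 3) (Fin 2) K)).restrictScalars 𝒪[K]) =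
      M ⊓ LinearMap.ker ((LinearMap.proj (1 : Fin 3) : (Fin 3 → K) →ₗ[K] K).restrictScalars 𝒪[K]))
    (hx₀ : x₀ ∈ M) (hx₀1 : Valued.v (x₀ 1) * Valued.v ϖ ^ b = 1) (hprx : x₀ - Pi.single 1 (x₀ 1) = ![w₀ 0, 0, w₀ 1])
    (γ₂ : GL (Fin 2) K) (u : GL (Fin 1) K) (m : ℕ) (hum : Valued.v ((u : Matrix (Fin 1) (Fin 1) K) 0 0 - 1) ≤ Valued.v (ϖ ^ m)) :
    latticeValueSetMod σ ϖ m M (((endoGL (γ₂, u) : GL (Fin 3) K) : Matrix (Fin 3) (Fin 3) K) - 1) =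
      {z : K | ∃ β ∈ B₂, ∃ a : K, Valued.v a ≤ 1 ∧
        Valued.v ((ϖ ^ m)⁻¹ * (z - pairing σ ((StdForm.antidiagonal 2).over K) (β + a • w₀)
          ((((γ₂ : Matrix (Fin 2) (Fin 2) K) - (u : Matrix (Fin 1) (Fin 1) K) 0 0 • (1 : Matrix (Fin 2) (Fin 2) K))) *ᵥ (β + a • w₀)))) ≤ 1} := by
  have hH : (StdForm.antidiagonal 3).over K =
      !![((StdForm.antidiagonal 2).over K) 0 0, 0, ((StdForm.antidiagonal 2).over K) 0 1; 0, (1 : K), 0; ((StdForm.antidiagonal 2).over K) 1 0, 0, ((StdForm.antidiagonal 2).over K) 1 1] := by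
    ext i j
    fin_cases i <;> fin_cases j <;> simp [StdForm.over, StdForm.antidiagonal_J_apply, Fin.rev]
  unfold Summit.HodgeConjecture.HodgeConjecture.Cruxes.H413.F0P3cDyRamFourFrameCensusDefs.latticeValueSetMod
  rw [hH] at hint ⊢
  exact valueSet_endoGL_sub_one_glued_eq_depthSet_of_v_sub_one_le σ hϖ ((StdForm.antidiagonal 2).over K) 1 hpr hint hB hx₀ hx₀1 hprx γ₂ u m hum

/-! ## §3 «DEPTH SCALING» — a `γ₂`-commuting similitude multiplies every depth value, hence the letter, by its multiplier (no domination hypothesis) -/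

omit [Valued K ℤᵐ⁰] in
/-- **THE DEPTH VALUE UNDER A `γ₂`-COMMUTING SIMILITUDE**: `⟨εx, εy⟩_{H₂} = ξ·⟨x, y⟩_{H₂}` for all `x, y` and `ε·γ₂ = γ₂·ε` give `⟨εv, (γ₂ − c)(εv)⟩ = ξ·⟨v, (γ₂ − c)v⟩` for every
`v` and scalar `c`. [cite: Jacobowitz1962, §4] -/
theorem depthPairing_mulVec_eq (σ : K →+* K) (H₂ : Matrix (Fin 2) (Fin 2) K) {ε : Matrix (Fin 2) (Fin 2) K} {ξ : K}
    (hε : ∀ x y : Fin 2 → K, pairing σ H₂ (ε *ᵥ x) (ε *ᵥ y) = ξ * pairing σ H₂ x y)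
    (γ₂ : Matrix (Fin 2) (Fin 2) K) (hεγ : ε * γ₂ = γ₂ * ε) (c : K) (v : Fin 2 → K) :
    pairing σ H₂ (ε *ᵥ v) ((γ₂ - c • (1 : Matrix (Fin 2) (Fin 2) K)) *ᵥ (ε *ᵥ v)) = ξ * pairing σ H₂ v ((γ₂ - c • (1 : Matrix (Fin 2) (Fin 2) K)) *ᵥ v) := by
  have hcomm : (γ₂ - c • (1 : Matrix (Fin 2) (Fin 2) K)) *ᵥ (ε *ᵥ v) = ε *ᵥ ((γ₂ - c • (1 : Matrix (Fin 2) (Fin 2) K)) *ᵥ v) := by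
    rw [Matrix.mulVec_mulVec, Matrix.mulVec_mulVec, sub_mul, mul_sub, Matrix.smul_mul, Matrix.mul_smul, Matrix.one_mul, Matrix.mul_one, hεγ]
  rw [hcomm, hε]

/-- **«DEPTH SCALING»: THE THICKENED DEPTH SET OVER `(ε·B₂, ε·w₀)` IS `ξ ·` THE ONE OVER `(B₂, w₀)`** (`ε` a `γ₂`-commuting similitude with unit multiplier `ξ`; every `γ₂`, `c`, `m`).
[cite: Jacobowitz1962, §4] [cite: Rogawski1990, §4.9 Prop. 4.9.1 (b) p. 55] -/
theorem depthSet_map_eq_image_mul (σ : K →+* K) (H₂ : Matrix (Fin 2) (Fin 2) K) {ε : Matrix (Fin 2) (Fin 2) K} {ξ : K} (hξ1 : Valued.v ξ = 1)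
    (hε : ∀ x y : Fin 2 → K, pairing σ H₂ (ε *ᵥ x) (ε *ᵥ y) = ξ * pairing σ H₂ x y)
    (γ₂ : Matrix (Fin 2) (Fin 2) K) (hεγ : ε * γ₂ = γ₂ * ε) (c : K)
    (B₂ : Submodule 𝒪[K] (Fin 2 → K)) (w₀ : Fin 2 → K) (ϖ : K) (m : ℕ) :
    {z : K | ∃ β ∈ B₂.map ((Matrix.toLin' ε).restrictScalars 𝒪[K]), ∃ a : K, Valued.v a ≤ 1 ∧
        Valued.v ((ϖ ^ m)⁻¹ * (z - pairing σ H₂ (β + a • (ε *ᵥ w₀)) ((γ₂ - c • (1 : Matrix (Fin 2) (Fin 2) K)) *ᵥ (β + a • (ε *ᵥ w₀))))) ≤ 1} =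
      (fun z => ξ * z) '' {z : K | ∃ β ∈ B₂, ∃ a : K, Valued.v a ≤ 1 ∧
        Valued.v ((ϖ ^ m)⁻¹ * (z - pairing σ H₂ (β + a • w₀) ((γ₂ - c • (1 : Matrix (Fin 2) (Fin 2) K)) *ᵥ (β + a • w₀)))) ≤ 1} := by
  have hξ0 : ξ ≠ 0 := fun h0 => by rw [h0, map_zero] at hξ1; exact zero_ne_one hξ1
  set D : (Fin 2 → K) → K := fun v => pairing σ H₂ v ((γ₂ - c • (1 : Matrix (Fin 2) (Fin 2) K)) *ᵥ v) with hD
  have hscale : ∀ v, D (ε *ᵥ v) = ξ * D v := fun v => depthPairing_mulVec_eq σ H₂ hε γ₂ hεγ c v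
  have hlin : ∀ (β₀ : Fin 2 → K) (a : K), ε *ᵥ β₀ + a • (ε *ᵥ w₀) = ε *ᵥ (β₀ + a • w₀) := fun β₀ a => by
    rw [Matrix.mulVec_add, Matrix.mulVec_smul]
  have hmem : ∀ β, β ∈ B₂.map ((Matrix.toLin' ε).restrictScalars 𝒪[K]) ↔ ∃ β₀ ∈ B₂, ε *ᵥ β₀ = β := fun β => by
    rw [Submodule.mem_map]
    simp only [LinearMap.coe_restrictScalars, Matrix.toLin'_apply]
  have hth : ∀ z t : K, Valued.v ((ϖ ^ m)⁻¹ * (z - ξ * t)) = Valued.v ((ϖ ^ m)⁻¹ * (ξ⁻¹ * z - t)) := fun z t => by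
    rw [show (ϖ ^ m)⁻¹ * (z - ξ * t) = ξ * ((ϖ ^ m)⁻¹ * (ξ⁻¹ * z - t)) by field_simp, map_mul, hξ1, one_mul]
  ext z
  simp only [Set.mem_setOf_eq, Set.mem_image]
  constructor
  · rintro ⟨β, hβ, a, ha, hz⟩
    obtain ⟨β₀, hβ₀, rfl⟩ := (hmem β).1 hβ
    refine ⟨ξ⁻¹ * z, ⟨β₀, hβ₀, a, ha, ?_⟩, by rw [mul_inv_cancel_left₀ hξ0]⟩
    have h1 : D (ε *ᵥ β₀ + a • (ε *ᵥ w₀)) = ξ * D (β₀ + a • w₀) := by rw [hlin, hscale]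
    have hz' : Valued.v ((ϖ ^ m)⁻¹ * (z - D (ε *ᵥ β₀ + a • (ε *ᵥ w₀)))) ≤ 1 := hz
    rw [h1, hth] at hz'
    exact hz'
  · rintro ⟨z', ⟨β₀, hβ₀, a, ha, hz'⟩, rfl⟩
    refine ⟨ε *ᵥ β₀, (hmem _).2 ⟨β₀, hβ₀, rfl⟩, a, ha, ?_⟩
    have h1 : D (ε *ᵥ β₀ + a • (ε *ᵥ w₀)) = ξ * D (β₀ + a • w₀) := by rw [hlin, hscale]
    show Valued.v ((ϖ ^ m)⁻¹ * (ξ * z' - D (ε *ᵥ β₀ + a • (ε *ᵥ w₀)))) ≤ 1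
    rw [h1, hth, inv_mul_cancel_left₀ hξ0]
    exact hz'

/-- **HEAD — «DEPTH SCALING» FOR THE VALUE SET OF `Γ − 1` ON INTEGRAL GLUED VERTICES, NO DOMINATION HYPOTHESIS.**  Two integral glued vertices `M` (over `(B₂, w₀)`, generator `x₀`)
and `M′` (over `(ε·B₂, ε·w₀)`, generator `x₀′`, same tube `b`), `ε` a `γ₂`-commuting similitude of `(K², H₂)` with unit multiplier `ξ`, `|u₀₀ − 1| ≤ |ϖ^m|`: the `ϖ^m`-value set of
`Γ − 1` on `M′` is `(ξ·) ''` that on `M` — on EVERY cone cell (★ p861069 `latticeValueSetMod_glued_map_eq_image_mul` needed both line terms `ϖ^m`-small).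
[cite: Rogawski1990, §4.9 Prop. 4.9.1 (b) p. 55] [cite: Jacobowitz1962, §4] [cite: Kottwitz1986BaseChangeUnits, §1 pp. 240–241] -/
theorem valueSet_endoGL_sub_one_glued_map_eq_image_mul_of_v_sub_one_le (σ : K →+* K) {ϖ : K} (hϖ : Valued.v ϖ = exp (-1 : ℤ)) (H₂ : Matrix (Fin 2) (Fin 2) K) (h : K)
    {M M' : Submodule 𝒪[K] (Fin 3 → K)} {b : ℕ} (hpr : ∀ x ∈ M, Valued.v (x 1) * Valued.v ϖ ^ b ≤ 1) (hpr' : ∀ x ∈ M', Valued.v (x 1) * Valued.v ϖ ^ b ≤ 1)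
    (hint : ∀ y ∈ M, Valued.v (pairing σ (!![H₂ 0 0, 0, H₂ 0 1; 0, h, 0; H₂ 1 0, 0, H₂ 1 1] : Matrix (Fin 3) (Fin 3) K) y y) ≤ 1)
    (hint' : ∀ y ∈ M', Valued.v (pairing σ (!![H₂ 0 0, 0, H₂ 0 1; 0, h, 0; H₂ 1 0, 0, H₂ 1 1] : Matrix (Fin 3) (Fin 3) K) y y) ≤ 1)
    {B₂ : Submodule 𝒪[K] (Fin 2 → K)} {w₀ : Fin 2 → K} {x₀ x₀' : Fin 3 → K} {ε : Matrix (Fin 2) (Fin 2) K} {ξ : K} (hξ1 : Valued.v ξ = 1)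
    (hε : ∀ x y : Fin 2 → K, pairing σ H₂ (ε *ᵥ x) (ε *ᵥ y) = ξ * pairing σ H₂ x y)
    (γ₂ : GL (Fin 2) K) (hεγ : ε * (γ₂ : Matrix (Fin 2) (Fin 2) K) = (γ₂ : Matrix (Fin 2) (Fin 2) K) * ε) (u : GL (Fin 1) K) (m : ℕ)
    (hum : Valued.v ((u : Matrix (Fin 1) (Fin 1) K) 0 0 - 1) ≤ Valued.v (ϖ ^ m))
    (hB : B₂.map ((Matrix.toLin' (!![1, 0; 0, 0; 0, 1] : Matrix (Fin 3) (Fin 2) K)).restrictScalars 𝒪[K]) =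
      M ⊓ LinearMap.ker ((LinearMap.proj (1 : Fin 3) : (Fin 3 → K) →ₗ[K] K).restrictScalars 𝒪[K]))
    (hB' : (B₂.map ((Matrix.toLin' ε).restrictScalars 𝒪[K])).map ((Matrix.toLin' (!![1, 0; 0, 0; 0, 1] : Matrix (Fin 3) (Fin 2) K)).restrictScalars 𝒪[K]) =
      M' ⊓ LinearMap.ker ((LinearMap.proj (1 : Fin 3) : (Fin 3 → K) →ₗ[K] K).restrictScalars 𝒪[K]))
    (hx₀ : x₀ ∈ M) (hx₀' : x₀' ∈ M') (hx₀1 : Valued.v (x₀ 1) * Valued.v ϖ ^ b = 1) (hx₀'1 : Valued.v (x₀' 1) * Valued.v ϖ ^ b = 1)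
    (hprx : x₀ - Pi.single 1 (x₀ 1) = ![w₀ 0, 0, w₀ 1]) (hprx' : x₀' - Pi.single 1 (x₀' 1) = ![(ε *ᵥ w₀) 0, 0, (ε *ᵥ w₀) 1]) :
    {z : K | ∃ y ∈ M', Valued.v ((ϖ ^ m)⁻¹ * (z - pairing σ (!![H₂ 0 0, 0, H₂ 0 1; 0, h, 0; H₂ 1 0, 0, H₂ 1 1] : Matrix (Fin 3) (Fin 3) K) y
        ((((endoGL (γ₂, u) : GL (Fin 3) K) : Matrix (Fin 3) (Fin 3) K) - 1) *ᵥ y))) ≤ 1} =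
      (fun z => ξ * z) '' {z : K | ∃ y ∈ M, Valued.v ((ϖ ^ m)⁻¹ * (z - pairing σ (!![H₂ 0 0, 0, H₂ 0 1; 0, h, 0; H₂ 1 0, 0, H₂ 1 1] : Matrix (Fin 3) (Fin 3) K) y
        ((((endoGL (γ₂, u) : GL (Fin 3) K) : Matrix (Fin 3) (Fin 3) K) - 1) *ᵥ y))) ≤ 1} := by
  rw [valueSet_endoGL_sub_one_glued_eq_depthSet_of_v_sub_one_le σ hϖ H₂ h hpr' hint' hB' hx₀' hx₀'1 hprx' γ₂ u m hum,
    valueSet_endoGL_sub_one_glued_eq_depthSet_of_v_sub_one_le σ hϖ H₂ h hpr hint hB hx₀ hx₀1 hprx γ₂ u m hum]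
  exact depthSet_map_eq_image_mul σ H₂ hξ1 hε _ hεγ _ B₂ w₀ ϖ m

/-- **«DEPTH SCALING» FOR THE CENSUS LETTER** (`Φ₃ = block(antidiag₂, 1)`): under `|u₀₀ − 1| ≤ |ϖ^m|`, for two integral glued vertices over `(B₂, w₀)` and `(ε·B₂, ε·w₀)` with `ε` a
`γ₂`-commuting similitude of `(K², Φ₂)` of unit multiplier `ξ`: `latticeValueSetMod σ ϖ m M′ (Γ − 1) = (ξ·) '' latticeValueSetMod σ ϖ m M (Γ − 1)` — the `hvs` dictionary of
★ p861154 §4 ∕ the exchange faces of ★ p861208 ∕ ★ p861237 on EVERY cone cell, axis or tube, below or above the conductor. [cite: Rogawski1990, §4.9 Prop. 4.9.1 (b) p. 55] [cite: Jacobowitz1962, §4] -/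
theorem latticeValueSetMod_glued_map_eq_image_mul_of_v_sub_one_le (σ : K →+* K) {ϖ : K} (hϖ : Valued.v ϖ = exp (-1 : ℤ))
    {M M' : Submodule 𝒪[K] (Fin 3 → K)} {b : ℕ} (hpr : ∀ x ∈ M, Valued.v (x 1) * Valued.v ϖ ^ b ≤ 1) (hpr' : ∀ x ∈ M', Valued.v (x 1) * Valued.v ϖ ^ b ≤ 1)
    (hint : ∀ y ∈ M, Valued.v (pairing σ ((StdForm.antidiagonal 3).over K) y y) ≤ 1) (hint' : ∀ y ∈ M', Valued.v (pairing σ ((StdForm.antidiagonal 3).over K) y y) ≤ 1)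
    {B₂ : Submodule 𝒪[K] (Fin 2 → K)} {w₀ : Fin 2 → K} {x₀ x₀' : Fin 3 → K} {ε : Matrix (Fin 2) (Fin 2) K} {ξ : K} (hξ1 : Valued.v ξ = 1)
    (hε : ∀ x y : Fin 2 → K, pairing σ ((StdForm.antidiagonal 2).over K) (ε *ᵥ x) (ε *ᵥ y) = ξ * pairing σ ((StdForm.antidiagonal 2).over K) x y)
    (γ₂ : GL (Fin 2) K) (hεγ : ε * (γ₂ : Matrix (Fin 2) (Fin 2) K) = (γ₂ : Matrix (Fin 2) (Fin 2) K) * ε) (u : GL (Fin 1) K) (m : ℕ)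
    (hum : Valued.v ((u : Matrix (Fin 1) (Fin 1) K) 0 0 - 1) ≤ Valued.v (ϖ ^ m))
    (hB : B₂.map ((Matrix.toLin' (!![1, 0; 0, 0; 0, 1] : Matrix (Fin 3) (Fin 2) K)).restrictScalars 𝒪[K]) =
      M ⊓ LinearMap.ker ((LinearMap.proj (1 : Fin 3) : (Fin 3 → K) →ₗ[K] K).restrictScalars 𝒪[K]))
    (hB' : (B₂.map ((Matrix.toLin' ε).restrictScalars 𝒪[K])).map ((Matrix.toLin' (!![1, 0; 0, 0; 0, 1] : Matrix (Fin 3) (Fin 2) K)).restrictScalars 𝒪[K]) =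
      M' ⊓ LinearMap.ker ((LinearMap.proj (1 : Fin 3) : (Fin 3 → K) →ₗ[K] K).restrictScalars 𝒪[K]))
    (hx₀ : x₀ ∈ M) (hx₀' : x₀' ∈ M') (hx₀1 : Valued.v (x₀ 1) * Valued.v ϖ ^ b = 1) (hx₀'1 : Valued.v (x₀' 1) * Valued.v ϖ ^ b = 1)
    (hprx : x₀ - Pi.single 1 (x₀ 1) = ![w₀ 0, 0, w₀ 1]) (hprx' : x₀' - Pi.single 1 (x₀' 1) = ![(ε *ᵥ w₀) 0, 0, (ε *ᵥ w₀) 1]) :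
    latticeValueSetMod σ ϖ m M' (((endoGL (γ₂, u) : GL (Fin 3) K) : Matrix (Fin 3) (Fin 3) K) - 1) =
      (fun z => ξ * z) '' latticeValueSetMod σ ϖ m M (((endoGL (γ₂, u) : GL (Fin 3) K) : Matrix (Fin 3) (Fin 3) K) - 1) := by
  rw [latticeValueSetMod_glued_eq_depthSet_of_v_sub_one_le σ hϖ hpr' hint' hB' hx₀' hx₀'1 hprx' γ₂ u m hum,
    latticeValueSetMod_glued_eq_depthSet_of_v_sub_one_le σ hϖ hpr hint hB hx₀ hx₀1 hprx γ₂ u m hum]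
  exact depthSet_map_eq_image_mul σ _ hξ1 hε _ hεγ _ B₂ w₀ ϖ m

end Summit.HodgeConjecture.HodgeConjecture.Cruxes.H413.F0P3cDyRamGlueValueDepthForm

end
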